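import Literature.NumberTheory.GaloisRepresentations.LubinTateColemanCoordFreeTwo
import Literature.NumberTheory.GaloisRepresentations.LubinTateColemanTwistCocycleTwo
import HarnessLib

/-!
# The `Δ = {±1}` part at `q = 2`: `σ_{−1}(1) = −ρ_{−1} ≡ 1 + Y (mod π, Y²)`, so `{1, σ_{−1}(1)}` is a `Λ(Γ')`-basis of the Coleman coordinate
# module — `𝒪_F⟦Y⟧ = Λ(Γ')·1 ⊕ Λ(Γ')·σ_{−1}(1)` is CYCLIC (free of rank one on `1`) over `Λ(ℤ₂^×) = Λ(Γ')[Δ]` (de Shalit I §3.1, §3.7)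

De Shalit, *Iwasawa theory of elliptic curves with complex multiplication* (1987), Ch. I §3.1 ("`ℤ_p⟦𝒢⟧ = Λ[Δ]`", for `p = 2`: `𝒢 ≅ ℤ₂^× = Δ × Γ'`,
`Δ = {±1}`, `Γ' = 1 + 4ℤ₂`) and Theorem I.3.7.  `LubinTateColemanCoordFreeTwo` proved that the coordinate module `𝒪_F⟦Y⟧` (`q = 2`, `π = 2u`) is
free of rank two over `Λ(Γ') = 𝒪_F⟦T⟧`, `T = σ_γ − 1`, with basis `{1, Y}`.  This file upgrades the basis to `{1, σ_{−1}(1)}` where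
`σ_{−1}(1) = (−1)·ρ_{−1}·(1 ∘ [−1]) = −ρ_{−1}` is the image of `1` under the non-trivial element of `Δ`:

* `coeff_two_hom_mul` — for any unit `v`: `π(1−π)·[X²][v]_f = v(1−v)`; ★ `coeff_two_hom_neg_one_add_mem` — `[X²][−1]_f ≡ −t (mod π)` (a unit;
  `2 = πt`), `coeff_two_redSeries_hom_neg_one` (`= 1` in `𝓀_F`);
* ★ `coeff_one_redSeries_rho_neg_one` — **`ρ_{−1} ≡ 1 + Y (mod π, Y²)`** (`(1+X)ρ̄(X²) = 1 + red[−1] = 1 + X + X² + …`);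
* ★ `coeff_one_tAct_pair_sub_mem` — for the rank-two coordinates, `[Y¹](a·1 + b·Y) ≡ b(0) (mod π)`;
* ★★ `isUnit_snd_of_pair_eq_neg_rho` — writing `−ρ_{−1} = a₁·1 + b₁·Y`, **`b₁` is a unit of `𝒪_F⟦T⟧`**;
* ★ `twistLinear_comm`, ★★ `tAct_twistLinear_comm` — the twists `D_v = 𝐋_v − 1` commute with each other (cocycle file
  `LubinTateColemanTwistCocycleTwo`: `𝐋_v𝐋_{v'} = 𝐋_{vv'}`) and hence **with the whole `𝒪_F⟦T⟧`-action**: `c·(D_{v'} r) = D_{v'}(c·r)` — the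
  `Λ(Γ')`-structure and `Δ` commute on ALL of `𝒪_F⟦Y⟧`, which is therefore a `Λ(Γ')[Δ] = Λ(ℤ₂^×)`-module;
* ★★★ `existsUnique_tAct_one_add_tAct_delta` — **every `r ∈ 𝒪_F⟦Y⟧` is UNIQUELY `a·1 + b·σ_{−1}(1)`** with `a, b ∈ 𝒪_F⟦T⟧`: the coordinate
  module is `Λ(Γ')·1 ⊕ Λ(Γ')·σ_{−1}(1)`, i.e. generated by `1` over `Λ(Γ')[Δ] = Λ(ℤ₂^×)` with no relations — **free of rank ONE over the
  full Iwasawa algebra of `𝒪_F^× ≅ Gal(K_π^∞/F)`**, de Shalit's "`𝒰 ≅ Λ(𝒢)`" (Theorem I.3.7) at `p = 2` on the series side.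

Everything PROVED (0 sorry, no named facts, no new definitions).

## References

* E. de Shalit, *Iwasawa theory of elliptic curves with complex multiplication* (1987), Ch. I §3.1, §3.4 Lemma (ii), §3.7. [deShalit1987]
* J. Lubin, J. Tate, *Formal complex multiplication in local fields*, Ann. of Math. 81 (1965), §1 (5). [LubinTate1965]
-/

noncomputable section

open scoped PowerSeries.WithPiTopology

namespace Literature.NumberTheory.GaloisRepresentations

section CoordDeltaTwo

open GaloisRepresentations.IsNonarchimedeanLocalField LubinTate ValuativeRel Finset

variable {F : Type} [Field F] [ValuativeRel F] [TopologicalSpace F] [IsNonarchimedeanLocalField F]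

attribute [local instance] ltNormUniformSpace ltNormIsUniformAddGroup rk1 nF nE fintypeResidueField

variable {π : 𝒪[F]} (hπ : (valuation F).IsUniformizer (π : F)) (hq : residueFieldCard F = 2)

/-! ### `[X²][v]_f` and the case `v = −1` -/

include hq in
/-- **`π(1 − π)·[X²][v]_f = v(1 − v)`** for every `v` (the `X²`-coefficient of `f∘[v] = [v]∘f`, `f = πX + X²`). [cite: LubinTate1965, §1 (5)] -/
theorem coeff_two_hom_mul (v : 𝒪[F]ˣ) :
    LTCoeff.of F π * (1 - LTCoeff.of F π) *
        PowerSeries.coeff 2 (hom (isLTRing_LTCoeff hπ) (isLTSeries_LTCoeff π) (isLTSeries_LTCoeff π) (LTCoeff.of F (v : 𝒪[F]))) =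
      LTCoeff.of F (v : 𝒪[F]) * (1 - LTCoeff.of F (v : 𝒪[F])) := by
  set H := hom (isLTRing_LTCoeff hπ) (isLTSeries_LTCoeff π) (isLTSeries_LTCoeff π) (LTCoeff.of F (v : 𝒪[F])) with hH
  have h0 : PowerSeries.coeff 0 H = 0 := by rw [PowerSeries.coeff_zero_eq_constantCoeff, hH]; exact constantCoeff_hom _ _ _ _
  have h1 : PowerSeries.coeff 1 H = LTCoeff.of F (v : 𝒪[F]) := by rw [hH, coeff_one_hom]
  have hrel : PowerSeries.C (LTCoeff.of F π) * H + H ^ 2 = PowerSeries.subst (ltSer F π) H := by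
    rw [← subst_ltSer_eq_two hq (by rw [← PowerSeries.coeff_zero_eq_constantCoeff, h0]), hH]
    exact subst_hom _ _ _ _
  have E2 := congrArg (PowerSeries.coeff 2) hrel
  rw [map_add, PowerSeries.coeff_C_mul, pow_two, PowerSeries.coeff_mul, Nat.sum_antidiagonal_eq_sum_range_succ_mk, coeff_subst_ltSer_two hq]
    at E2
  norm_num [sum_range_succ, h0, h1, Nat.choose] at E2
  linear_combination E2

include hq in
/-- ★ **`[X²][−1]_f + t ∈ (π)`** (`2 = πt`): from `π(1−π)a₂ = (−1)(1 − (−1)) = −2 = −πt`, `a₂(1−π) = −t`. [cite: LubinTate1965, §1 (5)] -/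
theorem coeff_two_hom_neg_one_add_mem {t : LTCoeff F} (ht : (2 : LTCoeff F) = LTCoeff.of F π * t) :
    PowerSeries.coeff 2 (hom (isLTRing_LTCoeff hπ) (isLTSeries_LTCoeff π) (isLTSeries_LTCoeff π) (LTCoeff.of F ((-1 : 𝒪[F]ˣ) : 𝒪[F]))) + t ∈
      Ideal.span {LTCoeff.of F π} := by
  haveI : IsDomain (LTCoeff F) := inferInstanceAs (IsDomain 𝒪[F])
  have h := coeff_two_hom_mul hπ hq (-1)
  set a₂ := PowerSeries.coeff 2 (hom (isLTRing_LTCoeff hπ) (isLTSeries_LTCoeff π) (isLTSeries_LTCoeff π) (LTCoeff.of F ((-1 : 𝒪[F]ˣ) : 𝒪[F])))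
  rw [Units.val_neg, Units.val_one, map_neg, map_one] at h
  have hπ0 : LTCoeff.of F π ≠ 0 := fun h0 => one_ne_zero ((isLTRing_LTCoeff hπ).eq_zero_of_mul_eq_zero 1 (by rw [h0, zero_mul]))
  -- cancel `π`: `a₂ (1 − π) = −t`
  have h2 : a₂ * (1 - LTCoeff.of F π) = -t := by
    refine mul_left_cancel₀ hπ0 ?_
    linear_combination h - ht
  refine Ideal.mem_span_singleton'.mpr ⟨a₂, ?_⟩
  linear_combination -h2

include hq in
/-- `[X²] red[−1]_f = 1` (`π = 2u`: `t = u⁻¹` is a unit). [cite: LubinTate1965, §1 (5)] -/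
theorem coeff_two_redSeries_hom_neg_one (u : (LTCoeff F)ˣ) (hu : LTCoeff.of F π = residueFieldCard F * u) :
    PowerSeries.coeff 2 (redSeries F (hom (isLTRing_LTCoeff hπ) (isLTSeries_LTCoeff π) (isLTSeries_LTCoeff π)
      (LTCoeff.of F ((-1 : 𝒪[F]ˣ) : 𝒪[F])))) = 1 := by
  have ht := two_eq_of_mul_inv hq u hu
  have h := coeff_two_hom_neg_one_add_mem hπ hq ht
  rw [← residue_eq_zero_iff_mem hπ, map_add, map_add] at h
  have htu : IsLocalRing.residue 𝒪[F] ((LTCoeff.of F).symm (↑u⁻¹ : LTCoeff F)) = 1 := by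
    obtain ⟨v, hv⟩ : ∃ v : 𝒪[F]ˣ, (v : 𝒪[F]) = (LTCoeff.of F).symm (↑u⁻¹ : LTCoeff F) :=
      ⟨Units.map (LTCoeff.of F).symm.toRingHom.toMonoidHom u⁻¹, rfl⟩
    have h := residue_of_unit_two hπ hq v
    rwa [hv, RingEquiv.apply_symm_apply] at h
  rw [htu] at h
  rw [coeff_redSeries]
  -- `x + 1 = 0` in characteristic two means `x = 1`
  haveI := charP_two_of_residueFieldCard (F := F) hq
  have h2 : (2 : 𝓀[F]) = 0 := by have := CharP.cast_eq_zero 𝓀[F] 2; simpa using this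
  linear_combination h - h2

/-! ### `ρ_{−1} ≡ 1 + Y (mod π, Y²)` -/

/-- ★ **`ρ_{−1} ≡ 1 + Y (mod π, Y²)`**: `[Y⁰] red ρ_{−1} = 1` and `[Y¹] red ρ_{−1} = 1` (reduce `(1 + tX)(ρ ∘ f) = 1 + t[−1]`:
`(1 + X)·ρ̄(X²) = 1 + X + X² + …`). [cite: deShalit1987, Ch. I §3.4 Lemma (ii)] -/
theorem coeff_redSeries_rho_neg_one (u : (LTCoeff F)ˣ) (hu : LTCoeff.of F π = residueFieldCard F * u) :
    PowerSeries.coeff 0 (redSeries F (evenPartTwo hπ hq (unitTwistSerTwo hπ (↑u⁻¹ : LTCoeff F) (-1)))) = 1 ∧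
    PowerSeries.coeff 1 (redSeries F (evenPartTwo hπ hq (unitTwistSerTwo hπ (↑u⁻¹ : LTCoeff F) (-1)))) = 1 := by
  have ht := two_eq_of_mul_inv hq u hu
  have c2 := coeff_two_redSeries_hom_neg_one hπ hq u hu
  have hrel := one_add_mul_subst_evenPartTwo_unitTwistSerTwo hπ hq ht (-1)
  set ρ := evenPartTwo hπ hq (unitTwistSerTwo hπ (↑u⁻¹ : LTCoeff F) (-1)) with hρ
  set Hb := redSeries F (hom (isLTRing_LTCoeff hπ) (isLTSeries_LTCoeff π) (isLTSeries_LTCoeff π) (LTCoeff.of F ((-1 : 𝒪[F]ˣ) : 𝒪[F])))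
    with hHb
  have c0 : PowerSeries.coeff 0 Hb = 0 := by
    rw [hHb, coeff_redSeries, PowerSeries.coeff_zero_eq_constantCoeff, constantCoeff_hom, map_zero, map_zero]
  have htu : IsLocalRing.residue 𝒪[F] ((LTCoeff.of F).symm (↑u⁻¹ : LTCoeff F)) = 1 := by
    obtain ⟨v, hv⟩ : ∃ v : 𝒪[F]ˣ, (v : 𝒪[F]) = (LTCoeff.of F).symm (↑u⁻¹ : LTCoeff F) :=
      ⟨Units.map (LTCoeff.of F).symm.toRingHom.toMonoidHom u⁻¹, rfl⟩
    have h := residue_of_unit_two hπ hq v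
    rwa [hv, RingEquiv.apply_symm_apply] at h
  have hexp : redSeries F (PowerSeries.subst (ltSer F π) ρ) = PowerSeries.expand 2 two_ne_zero (redSeries F ρ) := by
    rw [← redSeries_expand]
    refine (redSeries_eq_iff hπ _ _).mpr ?_
    have hgen : ∀ (q : ℕ) (hq0 : q ≠ 0), q = 2 → IsLTSeries (LTCoeff.of F π) q (ltSer F π) →
        PowerSeries.subst (ltSer F π) ρ - PowerSeries.expand 2 two_ne_zero ρ ∈ coeffIdeal (Ideal.span {LTCoeff.of F π}) := by
      rintro q hq0 rfl hf
      exact subst_sub_expand_mem_coeffIdeal hf two_ne_zero ρ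
    exact hgen (residueFieldCard F) (by rw [hq]; exact two_ne_zero) hq (isLTSeries_ltSer (F := F) π)
  have key : (1 + PowerSeries.X) * PowerSeries.expand 2 two_ne_zero (redSeries F ρ) = 1 + Hb := by
    have h := congrArg (redSeries F) hrel
    simp only [map_mul, map_add, map_one, redSeries_C, redSeries_X, htu, one_mul, hexp] at h
    exact h
  have hc : ∀ n, PowerSeries.coeff n ((1 + PowerSeries.X) * PowerSeries.expand 2 two_ne_zero (redSeries F ρ)) =
      PowerSeries.coeff n (PowerSeries.expand 2 two_ne_zero (redSeries F ρ)) +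
        (if n = 0 then 0 else PowerSeries.coeff (n - 1) (PowerSeries.expand 2 two_ne_zero (redSeries F ρ))) := fun n => by
    rw [add_mul, one_mul, map_add]
    congr 1
    rcases Nat.eq_zero_or_pos n with rfl | hn
    · rw [if_pos rfl, PowerSeries.coeff_zero_eq_constantCoeff, map_mul, PowerSeries.constantCoeff_X, zero_mul]
    · obtain ⟨m, rfl⟩ := Nat.exists_eq_add_of_le' hn
      rw [if_neg (Nat.succ_ne_zero m), PowerSeries.coeff_succ_X_mul, Nat.add_sub_cancel]
  have e0 := congrArg (PowerSeries.coeff 0) key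
  have e2 := congrArg (PowerSeries.coeff 2) key
  rw [hc, PowerSeries.coeff_expand, if_pos (dvd_zero 2), Nat.zero_div, if_pos rfl, add_zero, map_add, PowerSeries.coeff_one, if_pos rfl,
    c0, add_zero] at e0
  rw [hc, PowerSeries.coeff_expand, if_pos (dvd_refl 2), Nat.div_self two_pos, if_neg two_ne_zero, show (2 : ℕ) - 1 = 1 from rfl,
    PowerSeries.coeff_expand, if_neg (by norm_num), add_zero, map_add, PowerSeries.coeff_one, if_neg two_ne_zero, zero_add, c2] at e2
  exact ⟨e0, e2⟩

/-! ### The second rank-two coordinate of `σ_{−1}(1)` is a unit -/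

/-- ★ **`[Y¹](a·1 + b·Y) ≡ b(0) (mod π)`** for the rank-two coordinates (`a·1 ≡ a(0) + (J₂)`, `b·Y ≡ b(0)Y + (J₂)` since `D_γ 1 ∈ J₂`,
`D_γ Y ∈ J₃`). [cite: deShalit1987, Ch. I §3.1] -/
theorem coeff_one_tAct_pair_sub_mem (u : (LTCoeff F)ˣ) (hu : LTCoeff.of F π = residueFieldCard F * u) (γ w : 𝒪[F]ˣ)
    (hγ : (γ : 𝒪[F]) = 1 + π ^ 2 * w) (a b : PowerSeries (LTCoeff F)) :
    haveI := isAdicComplete_LTCoeff hπ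
    PowerSeries.coeff 1 (tAct (twistLinear hπ hq u γ) (twistLinear_mem_adicFiltGen_succ hπ hq u hu γ) a 1 +
        tAct (twistLinear hπ hq u γ) (twistLinear_mem_adicFiltGen_succ hπ hq u hu γ) b PowerSeries.X) - PowerSeries.constantCoeff b ∈
      Ideal.span {LTCoeff.of F π} := by
  haveI := isAdicComplete_LTCoeff hπ
  set D := twistLinear hπ hq u γ with hD
  have hD' := twistLinear_mem_adicFiltGen_succ hπ hq u hu γ
  have hT := twistLinear_X_pow_sub_mem_degFilt hπ hq u hu γ w hγ
  -- `a·1 ≡ a₀ + a₁ D 1 (mod I₂)`, `b·Y ≡ b₀ Y + b₁ D Y (mod I₂)`; `D 1, D Y ∈ J₂`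
  have hD1 : D 1 ∈ degFilt (LTCoeff.of F π) 2 := by
    have h := hT 0
    rw [pow_zero, Nat.zero_add] at h
    have h' := add_mem (degFilt_mono (by norm_num) h) (X_pow_mem_degFilt (p := LTCoeff.of F π) (m := 2) (n := 2) le_rfl)
    rwa [sub_add_cancel] at h'
  have hDX : D PowerSeries.X ∈ degFilt (LTCoeff.of F π) 2 := by
    have h := hT 1
    rw [pow_one] at h
    have h' := add_mem (degFilt_mono (by norm_num) h) (X_pow_mem_degFilt (p := LTCoeff.of F π) (m := 2) (n := 1 + 2) (by norm_num))
    rwa [sub_add_cancel] at h'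
  have ha : tAct D hD' a 1 - PowerSeries.C (PowerSeries.coeff 0 a) ∈ degFilt (LTCoeff.of F π) 2 := by
    have h1 := adicFiltGen_le_degFilt 2 (tAct_sub_tPartial_mem hD' a 1 2)
    have h2 : tPartial D a 1 2 - PowerSeries.C (PowerSeries.coeff 0 a) ∈ degFilt (LTCoeff.of F π) 2 := by
      rw [tPartial_def, sum_range_succ, sum_range_one, Function.iterate_zero_apply, Function.iterate_one, mul_one, add_sub_cancel_left]
      exact Ideal.mul_mem_left _ _ hD1
    have h := add_mem h1 h2
    rwa [sub_add_sub_cancel] at h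
  have hb : tAct D hD' b PowerSeries.X - PowerSeries.C (PowerSeries.coeff 0 b) * PowerSeries.X ∈ degFilt (LTCoeff.of F π) 2 := by
    have h1 := adicFiltGen_le_degFilt 2 (tAct_sub_tPartial_mem hD' b PowerSeries.X 2)
    have h2 : tPartial D b PowerSeries.X 2 - PowerSeries.C (PowerSeries.coeff 0 b) * PowerSeries.X ∈ degFilt (LTCoeff.of F π) 2 := by
      rw [tPartial_def, sum_range_succ, sum_range_one, Function.iterate_zero_apply, Function.iterate_one, add_sub_cancel_left]
      exact Ideal.mul_mem_left _ _ hDX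
    have h := add_mem h1 h2
    rwa [sub_add_sub_cancel] at h
  have h := add_mem ha hb 1 (by norm_num)
  rwa [map_add, map_sub, map_sub, PowerSeries.coeff_C, if_neg one_ne_zero, sub_zero, PowerSeries.coeff_C_mul, PowerSeries.coeff_one_X, mul_one,
    add_sub, ← map_add, PowerSeries.coeff_zero_eq_constantCoeff] at h

include hπ in
/-- `1 − x` is a unit of `𝒪_F` for `x ∈ (π)` (`𝒪_F` is local with maximal ideal `(π)`). [cite: deShalit1987, Ch. I §3.1] -/
theorem isUnit_one_sub_of_mem_span_pi {x : LTCoeff F} (hx : x ∈ Ideal.span {LTCoeff.of F π}) : IsUnit (1 - x) := by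
  obtain ⟨c, hc⟩ := Ideal.mem_span_singleton'.mp hx
  have hx' : (LTCoeff.of F).symm x ∈ 𝓂[F] := by
    rw [maximalIdeal_eq_span_singleton hπ]
    refine Ideal.mem_span_singleton'.mpr ⟨(LTCoeff.of F).symm c, ?_⟩
    apply (LTCoeff.of F).injective
    rw [map_mul, RingEquiv.apply_symm_apply, RingEquiv.apply_symm_apply, hc]
  have h := IsLocalRing.isUnit_one_sub_self_of_mem_nonunits _ hx'
  have h' := h.map (LTCoeff.of F)
  rwa [map_sub, map_one, RingEquiv.apply_symm_apply] at h'

/-- ★★ **The `Y`-coordinate of `σ_{−1}(1) = −ρ_{−1}` is a unit of `𝒪_F⟦T⟧`**: if `−ρ_{−1} = a₁·1 + b₁·Y` then `b₁(0) ≡ [Y¹](−ρ_{−1}) ≡ −1 (mod π)`.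
[cite: deShalit1987, Ch. I §3.1, §3.4 Lemma (ii)] -/
theorem isUnit_snd_of_pair_eq_neg_rho (u : (LTCoeff F)ˣ) (hu : LTCoeff.of F π = residueFieldCard F * u) (γ w : 𝒪[F]ˣ)
    (hγ : (γ : 𝒪[F]) = 1 + π ^ 2 * w) {a₁ b₁ : PowerSeries (LTCoeff F)}
    (h : haveI := isAdicComplete_LTCoeff hπ
      tAct (twistLinear hπ hq u γ) (twistLinear_mem_adicFiltGen_succ hπ hq u hu γ) a₁ 1 +
        tAct (twistLinear hπ hq u γ) (twistLinear_mem_adicFiltGen_succ hπ hq u hu γ) b₁ PowerSeries.X =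
      -evenPartTwo hπ hq (unitTwistSerTwo hπ (↑u⁻¹ : LTCoeff F) (-1))) : IsUnit b₁ := by
  haveI := isAdicComplete_LTCoeff hπ
  refine PowerSeries.isUnit_iff_constantCoeff.mpr ?_
  have h1 := coeff_one_tAct_pair_sub_mem hπ hq u hu γ w hγ a₁ b₁
  rw [h, map_neg] at h1
  -- `[Y¹]ρ_{−1} ≡ 1 (mod π)`
  have hρ1 : PowerSeries.coeff 1 (evenPartTwo hπ hq (unitTwistSerTwo hπ (↑u⁻¹ : LTCoeff F) (-1))) - 1 ∈ Ideal.span {LTCoeff.of F π} := by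
    rw [← residue_eq_zero_iff_mem hπ, map_sub, map_sub, map_one, map_one, sub_eq_zero, ← coeff_redSeries]
    exact (coeff_redSeries_rho_neg_one hπ hq u hu).2
  -- `(ρ₁ − 1) + (−ρ₁ − b₁(0)) = −(1 + b₁(0)) ∈ (π)`, so `b₁(0) = −(1 − (1 + b₁(0)))` is a unit
  have hmem : 1 + PowerSeries.constantCoeff b₁ ∈ Ideal.span {LTCoeff.of F π} := by
    have h := add_mem hρ1 h1
    have e : PowerSeries.coeff 1 (evenPartTwo hπ hq (unitTwistSerTwo hπ (↑u⁻¹ : LTCoeff F) (-1))) - 1 +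
        (-PowerSeries.coeff 1 (evenPartTwo hπ hq (unitTwistSerTwo hπ (↑u⁻¹ : LTCoeff F) (-1))) - PowerSeries.constantCoeff b₁) =
        -(1 + PowerSeries.constantCoeff b₁) := by ring
    rw [e, neg_mem_iff] at h
    exact h
  have hunit := isUnit_one_sub_of_mem_span_pi hπ hmem
  rw [sub_add_cancel_left] at hunit
  exact (IsUnit.neg_iff _).mp hunit

/-! ### The `Λ(Γ')`-action commutes with every twist (`Δ` included) -/

/-- `𝐋_v(𝐋_{v'} r) = 𝐋_{vv'} r` in terms of `twistLinear` (`𝐋_v = D_v + 1`). [cite: deShalit1987, Ch. I §3.4 Lemma (ii)] -/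
theorem twistLinear_comp_add (u : (LTCoeff F)ˣ) (hu : LTCoeff.of F π = residueFieldCard F * u) (v v' : 𝒪[F]ˣ) (r : PowerSeries (LTCoeff F)) :
    twistLinear hπ hq u v (twistLinear hπ hq u v' r + r) + (twistLinear hπ hq u v' r + r) = twistLinear hπ hq u (v * v') r + r := by
  rw [twistLinear_apply hπ hq u v' r, sub_add_cancel, twistLinear_apply, sub_add_cancel, twistLinear_apply, sub_add_cancel]
  exact unitTwist_comp hπ hq u hu v v' r

/-- ★ **The twists commute: `D_v(D_{v'} r) = D_{v'}(D_v r)`.** [cite: deShalit1987, Ch. I §3.4 Lemma (ii), §3.7] -/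
theorem twistLinear_comm (u : (LTCoeff F)ˣ) (hu : LTCoeff.of F π = residueFieldCard F * u) (v v' : 𝒪[F]ˣ) (r : PowerSeries (LTCoeff F)) :
    twistLinear hπ hq u v (twistLinear hπ hq u v' r) = twistLinear hπ hq u v' (twistLinear hπ hq u v r) := by
  have h1 := twistLinear_comp_add hπ hq u hu v v' r
  have h2 := twistLinear_comp_add hπ hq u hu v' v r
  rw [mul_comm v' v] at h2
  rw [map_add] at h1 h2
  linear_combination h1 - h2

/-- ★★ **The `𝒪_F⟦T⟧`-action commutes with every twist**: `c·(D_{v'} r) = D_{v'}(c·r)` for `T = D_γ`, any `v' ∈ 𝒪_F^×` (e.g. `v' = −1`): the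
`Λ(Γ')`-structure and `Δ` commute on all of `𝒪_F⟦Y⟧` (`D_{v'}` is linear, continuous and commutes with `D_γ`). [cite: deShalit1987, Ch. I §3.4 Lemma (ii), §3.7] -/
theorem tAct_twistLinear_comm (u : (LTCoeff F)ˣ) (hu : LTCoeff.of F π = residueFieldCard F * u) (γ v' : 𝒪[F]ˣ) (c r : PowerSeries (LTCoeff F)) :
    haveI := isAdicComplete_LTCoeff hπ
    tAct (twistLinear hπ hq u γ) (twistLinear_mem_adicFiltGen_succ hπ hq u hu γ) c (twistLinear hπ hq u v' r) =
      twistLinear hπ hq u v' (tAct (twistLinear hπ hq u γ) (twistLinear_mem_adicFiltGen_succ hπ hq u hu γ) c r) := by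
  haveI := isAdicComplete_LTCoeff hπ
  have hD := twistLinear_mem_adicFiltGen_succ hπ hq u hu γ
  have hiter : ∀ k (s : PowerSeries (LTCoeff F)), (⇑(twistLinear hπ hq u γ))^[k] (twistLinear hπ hq u v' s) =
      twistLinear hπ hq u v' ((⇑(twistLinear hπ hq u γ))^[k] s) := by
    intro k
    induction k with
    | zero => intro s; rfl
    | succ k ih => intro s; rw [Function.iterate_succ_apply, Function.iterate_succ_apply, twistLinear_comm hπ hq u hu γ v' s, ih]
  symm
  refine eq_tAct_of_forall_sub_mem hD fun K => ?_
  have e : tPartial (twistLinear hπ hq u γ) c (twistLinear hπ hq u v' r) K = twistLinear hπ hq u v' (tPartial (twistLinear hπ hq u γ) c r K) := by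
    rw [tPartial_def, tPartial_def, map_sum]
    refine Finset.sum_congr rfl fun k _ => ?_
    rw [hiter, ← PowerSeries.smul_eq_C_mul, ← PowerSeries.smul_eq_C_mul, map_smul]
  rw [e, ← map_sub]
  exact adicFiltGen_mono (Nat.le_succ K) (twistLinear_mem_adicFiltGen_succ hπ hq u hu v' K _ (tAct_sub_tPartial_mem hD c r K))

/-! ### `𝒪_F⟦Y⟧ = Λ(Γ')·1 ⊕ Λ(Γ')·σ_{−1}(1)` -/

/-- ★★★ **Every `r ∈ 𝒪_F⟦Y⟧` is UNIQUELY `a·1 + b·σ_{−1}(1)`** (`σ_{−1}(1) = −ρ_{−1}`, `a, b ∈ 𝒪_F⟦T⟧`, `T = σ_γ − 1`, `γ = 1 + π²w`): the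
Coleman coordinate module at `q = 2` is `Λ(Γ')·1 ⊕ Λ(Γ')·σ_{−1}(1)` — generated by the single element `1` over `Λ(Γ')[Δ] = Λ(ℤ₂^×)`
(`Δ = {±1}`) with no relations: **free of rank one over the Iwasawa algebra of `Gal(K_π^∞/F) ≅ 𝒪_F^×`**, de Shalit I §3.1/3.7 at `p = 2` on the
series side. [cite: deShalit1987, Ch. I §3.1, §3.7] -/
theorem existsUnique_tAct_one_add_tAct_delta (u : (LTCoeff F)ˣ) (hu : LTCoeff.of F π = residueFieldCard F * u) (γ w : 𝒪[F]ˣ)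
    (hγ : (γ : 𝒪[F]) = 1 + π ^ 2 * w) (r : PowerSeries (LTCoeff F)) :
    haveI := isAdicComplete_LTCoeff hπ
    ∃! ab : PowerSeries (LTCoeff F) × PowerSeries (LTCoeff F),
      tAct (twistLinear hπ hq u γ) (twistLinear_mem_adicFiltGen_succ hπ hq u hu γ) ab.1 1 +
        tAct (twistLinear hπ hq u γ) (twistLinear_mem_adicFiltGen_succ hπ hq u hu γ) ab.2
          (-evenPartTwo hπ hq (unitTwistSerTwo hπ (↑u⁻¹ : LTCoeff F) (-1))) = r := by
  haveI := isAdicComplete_LTCoeff hπ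
  have hD := twistLinear_mem_adicFiltGen_succ hπ hq u hu γ
  obtain ⟨hex, huniq⟩ := exists_tAct_twistLinear_two_and_unique hπ hq u hu γ w hγ
  -- the rank-two coordinates of `σ_{−1}(1)` and of `r`
  obtain ⟨a₁, b₁, h₁⟩ := hex (-evenPartTwo hπ hq (unitTwistSerTwo hπ (↑u⁻¹ : LTCoeff F) (-1)))
  obtain ⟨a, b, hr⟩ := hex r
  have hb₁ : IsUnit b₁ := isUnit_snd_of_pair_eq_neg_rho hπ hq u hu γ w hγ h₁
  obtain ⟨b₁u, hb₁u⟩ := hb₁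
  set e := -evenPartTwo hπ hq (unitTwistSerTwo hπ (↑u⁻¹ : LTCoeff F) (-1)) with he
  -- `c·e = (c a₁)·1 + (c b₁)·Y`
  have hce : ∀ c : PowerSeries (LTCoeff F), tAct (twistLinear hπ hq u γ) hD c e =
      tAct (twistLinear hπ hq u γ) hD (c * a₁) 1 + tAct (twistLinear hπ hq u γ) hD (c * b₁) PowerSeries.X := fun c => by
    rw [← h₁, tAct_add_right, tAct_mul, tAct_mul]
  refine ⟨(a - b * ↑b₁u⁻¹ * a₁, b * ↑b₁u⁻¹), ?_, fun ab hab => ?_⟩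
  · change tAct (twistLinear hπ hq u γ) hD (a - b * ↑b₁u⁻¹ * a₁) 1 + tAct (twistLinear hπ hq u γ) hD (b * ↑b₁u⁻¹) e = r
    rw [hce, ← hr, tAct_sub_left, show b * ↑b₁u⁻¹ * b₁ = b by rw [← hb₁u, Units.inv_mul_cancel_right]]
    ring
  · -- uniqueness: compare rank-two coordinates
    have hab' : tAct (twistLinear hπ hq u γ) hD (ab.1 + ab.2 * a₁) 1 + tAct (twistLinear hπ hq u γ) hD (ab.2 * b₁) PowerSeries.X = r := by
      rw [← hab, hce, tAct_add_left]; ring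
    have hc := huniq (ab.1 + ab.2 * a₁) (ab.2 * b₁) a b (hab'.trans hr.symm)
    have h2 : ab.2 = b * ↑b₁u⁻¹ := by rw [← hc.2, ← hb₁u, Units.mul_inv_cancel_right]
    have h1 : ab.1 = a - b * ↑b₁u⁻¹ * a₁ := by rw [← h2, ← hc.1]; ring
    exact Prod.ext h1 h2

end CoordDeltaTwo

end Literature.NumberTheory.GaloisRepresentations
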